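import Mathlib
import Summits.Ventures.PercRepro2.HCov
import Summits.Ventures.PercRepro2.HCovCubic
import Summits.Ventures.PercRepro2.TriDisagreement
import Summits.Ventures.PercRepro2.TriDisagreementPinned
import Summits.Ventures.PercRepro2.OneTypedEdge

/-!
# Typed deletion: a pinned-closed non-loop edge may be re-routed to a loop (blind cell PercRepro2,
p1 g11; the «typed deletion» step of the typed bridge, P1-CCWBRIDGE §9)

In a typed instance `(F, z, τ)` an edge `g ∉ F` with `z g = false` is closed in all three copies
of every triple counted, so the kernel `K₃` — a function of the connection state (`K3_eq_KB`) —
does not see where `g` goes: **`typedCount_closed_reroute`**: `typedCount F z τ K₃(ends) =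
typedCount F z τ K₃(ends[g ↦ s(u, u)])`. With it every pinned-closed non-loop edge of an instance
can be removed structurally (one non-loop edge fewer) before the typed rules are applied.
-/

namespace Summit.Ventures.PercRepro2

open CovForm CovForm.OneTyped

namespace TypedDel

section Conn

variable {V : Type*} {E : Type*} [DecidableEq E]

/-- With `g` closed, the open graph does not depend on the ends of `g`. -/
lemma openGraph_update_ends_of_closed (ends : E → Sym2 V) {g : E} (s : Sym2 V) {ω : Config E}
    (hg : ω g = false) : openGraph (Function.update ends g s) ω = openGraph ends ω := by
  ext u v
  simp only [openGraph_adj, OpenAdj]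
  constructor
  · rintro ⟨huv, f, hf, hends⟩
    by_cases hfg : f = g
    · subst hfg
      rw [hf] at hg
      cases hg
    · rw [Function.update_of_ne hfg] at hends
      exact ⟨huv, f, hf, hends⟩
  · rintro ⟨huv, f, hf, hends⟩
    by_cases hfg : f = g
    · subst hfg
      rw [hf] at hg
      cases hg
    · exact ⟨huv, f, hf, by rw [Function.update_of_ne hfg]; exact hends⟩

/-- With `g` closed, connectivity does not depend on the ends of `g`. -/
lemma conn_update_ends_of_closed (ends : E → Sym2 V) {g : E} (s : Sym2 V) {ω : Config E}
    (hg : ω g = false) (x z : V) :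
    Conn (Function.update ends g s) ω x z ↔ Conn ends ω x z := by
  unfold Conn
  rw [openGraph_update_ends_of_closed ends s hg]

end Conn

section Typed

variable {V : Type*} {E : Type*} [Fintype E] [DecidableEq E] {R : Type*} [Field R]

omit [Fintype E] in
/-- With `g` closed, the state does not depend on the ends of `g`. -/
lemma st_update_ends_of_closed (ends : E → Sym2 V) (o a₁ a₂ a₃ b : V) {g : E} (s : Sym2 V)
    {ω : Config E} (hg : ω g = false) :
    st (Function.update ends g s) o a₁ a₂ a₃ b ω = st ends o a₁ a₂ a₃ b ω := by
  have h := conn_update_ends_of_closed ends s hg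
  unfold st
  simp only [Prod.mk.injEq]
  exact ⟨decide_eq_decide.mpr (h _ _), decide_eq_decide.mpr (h _ _), decide_eq_decide.mpr (h _ _),
    decide_eq_decide.mpr (h _ _), decide_eq_decide.mpr (h _ _), decide_eq_decide.mpr (h _ _),
    decide_eq_decide.mpr (h _ _)⟩

/-- **Typed deletion**: a pinned-closed edge `g ∉ F` may be re-routed to any ends, in particular to
a loop, without changing the typed count. -/
theorem typedCount_closed_reroute (ends : E → Sym2 V) (o a₁ a₂ a₃ b : V) {g : E} (s : Sym2 V)
    (F : Finset E) (hgF : g ∉ F) (z : Config E) (hz : z g = false) (τ : E → ℕ) :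
    typedCount F z τ (K3 (Function.update ends g s) o a₁ a₂ a₃ b : Config E → Config E → Config E → R) =
      typedCount F z τ (K3 ends o a₁ a₂ a₃ b) := by
  unfold typedCount
  refine Finset.sum_congr rfl fun x _ => Finset.sum_congr rfl fun y _ =>
    Finset.sum_congr rfl fun w _ => ?_
  by_cases hc : (∀ e, e ∉ F → x e = z e ∧ y e = z e ∧ w e = z e) ∧ ∀ e ∈ F, openCount x y w e = τ e
  · rw [if_pos hc, if_pos hc]
    obtain ⟨hx, hy, hw⟩ := hc.1 g hgF
    rw [K3_eq_KB, K3_eq_KB, st_update_ends_of_closed ends o a₁ a₂ a₃ b s (hx.trans hz),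
      st_update_ends_of_closed ends o a₁ a₂ a₃ b s (hy.trans hz),
      st_update_ends_of_closed ends o a₁ a₂ a₃ b s (hw.trans hz)]
  · rw [if_neg hc, if_neg hc]

end Typed

end TypedDel

end Summit.Ventures.PercRepro2
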